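import Summits.CriticalPhenomena.PercolationContinuityZ3.Theorems.PercNearOneGluingNoHeavyLowerTailSahiThreeCopyBlockOr
import Summits.CriticalPhenomena.PercolationContinuityZ3.Theorems.PercNearOneGluingNoHeavyLowerTailSahiThreeCopyGadget

/-!
# `NoHeavyLowerTail` (crux stmt-CriticalPhenomena-4575), Sahi programme: **the theorem-grade linear inequalities among the fifteen three-copy
# counts of a monotone triple** (`MixedFacts`) — infrastructure for the mixed-literal adjunction theorem of `…SahiThreeCopyMixedLiterals`

Support file (Sahi cell, seat `prim-sahi-p1`, generation 54; `--supports stmt-CriticalPhenomena-4575`).  Pure proofs plus one `Prop`-structure (a hypothesis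
bundle); no `sorry`, standard axioms.

For monotone `f, g, h : {0,1}^d → [0,1]` and a profile `b`, the fifteen numbers `Z = N_b(1;1;1)`, `N_b(f;1;1)`, `N_b(g;1;1)`, `N_b(h;1;1)`, `N_b(fg;1;1)`,
`N_b(f;g;1)`, `N_b(fh;1;1)`, `N_b(f;h;1)`, `N_b(gh;1;1)`, `N_b(g;h;1)`, `N_b(fgh;1;1)`, `N_b(f;gh;1)`, `N_b(g;fh;1)`, `N_b(h;fg;1)`, `N_b(f;g;h)` satisfy
(`mixedFacts_of`): nonnegativity; monotonicity chains; three-copy Harris (`N(fg) ≥ N(f;g)`, `N(fgh) ≥ N(f;gh)`, `N(f;gh) ≥ N(f;g;h)`); SPECTATOR-HARRIS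
`N(fg) − N(f;g) ≥ N(h;fg) − N(f;g;h)` (the Harris gap with spectator `1−h ≥ 0`); UNION-HARRIS `H(f,g) + H(f,h) ≥ N(fgh) − N(f;gh)` (`= H(f, g∨h) ≥ 0`); and the
BONFERRONI nonnegativities `N(f(1−g)(1−h);1;1)`, `N(f(1−g);1−h;1)`, `N((1−f)(1−g);1;1)`, `N(1−f;1−g;1)`, `N((1−f)(1−g)(1−h);1;1)`, `N(1−f;1−g;1−h)`,
`N((1−f)(1−g);1−h;1) ≥ 0`, all written out in the fifteen coordinates.  Together with `c_b(f,g,h) ≥ 0` these are exactly the inequalities from which every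
mixed single-literal extension of the three-copy Sahi inequality follows linearly (memo FROM-prim-sahi-p1-gen54-READONCE-CLOSURE §3e). [this work]
-/

namespace Summit.CriticalPhenomena.PercolationContinuityZ3.Theorems.SahiThreeCopy

open Finset Function Literature.Combinatorics.Sahi2008
open scoped BigOperators

noncomputable section

variable {d : ℕ}

/-- The theorem-grade linear inequalities among the fifteen three-copy counts of a monotone `[0,1]`-valued triple (hypothesis bundle). [this work] -/
structure MixedFacts (Z nf ng nh hfg sfg hfh sfh hgh sgh n0 nA nB nC n3 : ℝ) : Prop where
  -- nonnegativity
  z0 : 0 ≤ Z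
  nf0 : 0 ≤ nf
  ng0 : 0 ≤ ng
  nh0 : 0 ≤ nh
  hfg0 : 0 ≤ hfg
  sfg0 : 0 ≤ sfg
  hfh0 : 0 ≤ hfh
  sfh0 : 0 ≤ sfh
  hgh0 : 0 ≤ hgh
  sgh0 : 0 ≤ sgh
  n00 : 0 ≤ n0
  nA0 : 0 ≤ nA
  nB0 : 0 ≤ nB
  nC0 : 0 ≤ nC
  n30 : 0 ≤ n3
  -- singles ≤ Z, pairs ≤ singles, triple ≤ pairs
  fZ : nf ≤ Z
  gZ : ng ≤ Z
  hZ : nh ≤ Z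
  fg_f : hfg ≤ nf
  fg_g : hfg ≤ ng
  fh_f : hfh ≤ nf
  fh_h : hfh ≤ nh
  gh_g : hgh ≤ ng
  gh_h : hgh ≤ nh
  sfg_f : sfg ≤ nf
  sfg_g : sfg ≤ ng
  sfh_f : sfh ≤ nf
  sfh_h : sfh ≤ nh
  sgh_g : sgh ≤ ng
  sgh_h : sgh ≤ nh
  n0_fg : n0 ≤ hfg
  n0_fh : n0 ≤ hfh
  n0_gh : n0 ≤ hgh
  nA_sfg : nA ≤ sfg
  nA_sfh : nA ≤ sfh
  nB_sfg : nB ≤ sfg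
  nB_sgh : nB ≤ sgh
  nC_sfh : nC ≤ sfh
  nC_sgh : nC ≤ sgh
  -- Harris
  Hfg : sfg ≤ hfg
  Hfh : sfh ≤ hfh
  Hgh : sgh ≤ hgh
  HA : nA ≤ n0
  HB : nB ≤ n0
  HC : nC ≤ n0
  H3A : n3 ≤ nA
  H3B : n3 ≤ nB
  H3C : n3 ≤ nC
  -- spectator Harris
  SpC : nC - n3 ≤ hfg - sfg
  SpB : nB - n3 ≤ hfh - sfh
  SpA : nA - n3 ≤ hgh - sgh
  -- union Harris
  Uf : n0 - nA ≤ (hfg - sfg) + (hfh - sfh)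
  Ug : n0 - nB ≤ (hfg - sfg) + (hgh - sgh)
  Uh : n0 - nC ≤ (hfh - sfh) + (hgh - sgh)
  -- Bonferroni
  Bf : 0 ≤ nf - hfg - hfh + n0
  Bg : 0 ≤ ng - hfg - hgh + n0
  Bh : 0 ≤ nh - hfh - hgh + n0
  Bfg_h : 0 ≤ nf - hfg - sfh + nC
  Bfh_g : 0 ≤ nf - hfh - sfg + nB
  Bgf_h : 0 ≤ ng - hfg - sgh + nC
  Bgh_f : 0 ≤ ng - hgh - sfg + nA
  Bhf_g : 0 ≤ nh - hfh - sgh + nB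
  Bhg_f : 0 ≤ nh - hgh - sfh + nA
  I2fg : 0 ≤ Z - nf - ng + hfg
  I2fh : 0 ≤ Z - nf - nh + hfh
  I2gh : 0 ≤ Z - ng - nh + hgh
  I2fg' : 0 ≤ Z - nf - ng + sfg
  I2fh' : 0 ≤ Z - nf - nh + sfh
  I2gh' : 0 ≤ Z - ng - nh + sgh
  I3 : 0 ≤ Z - nf - ng - nh + hfg + hfh + hgh - n0
  I3' : 0 ≤ Z - nf - ng - nh + sfg + sfh + sgh - n3
  I3f : 0 ≤ Z - nf - ng - nh + hgh + sfg + sfh - nA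
  I3g : 0 ≤ Z - nf - ng - nh + hfh + sfg + sgh - nB
  I3h : 0 ≤ Z - nf - ng - nh + hfg + sfh + sgh - nC

section Facts

variable (b : Fin d → ℕ) {f g h : Pt d → ℝ}

/-- Spectator-Harris in coordinates: `N(h;fg;1) − N(f;g;h) ≤ N(fg;1;1) − N(f;g;1)` (three-copy Harris with the spectator `1 − h ≥ 0`). [this work] -/
theorem spec_harris (hf0 : ∀ x, 0 ≤ f x) (hfm : Monotone f) (hg0 : ∀ x, 0 ≤ g x) (hgm : Monotone g) (hh1 : ∀ x, h x ≤ 1) :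
    N3 b h (f * g) 1 - N3 b f g h ≤ N3 b (f * g) 1 1 - N3 b f g 1 := by
  have w0 : ∀ x, 0 ≤ (1 - h) x := fun x => sub_nonneg.2 (hh1 x)
  have := harris3_nonneg b hf0 hfm hg0 hgm w0
  rw [N3_sub_right, N3_sub_right, N3_comm23 b (f * g) 1 h, N3_comm12 b (f * g) h 1] at this
  linarith

/-- Union-Harris in coordinates: `N(fgh) − N(f;gh) ≤ H(f,g) + H(f,h)` (`= H(f, g ∨ h) ≥ 0`). [this work] -/
theorem union_harris (hf0 : ∀ x, 0 ≤ f x) (hfm : Monotone f) (hg0 : ∀ x, 0 ≤ g x) (hg1 : ∀ x, g x ≤ 1) (hgm : Monotone g)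
    (hh0 : ∀ x, 0 ≤ h x) (hh1 : ∀ x, h x ≤ 1) (hhm : Monotone h) :
    N3 b (f * g * h) 1 1 - N3 b f (g * h) 1 ≤ (N3 b (f * g) 1 1 - N3 b f g 1) + (N3 b (f * h) 1 1 - N3 b f h 1) := by
  obtain ⟨o0, om⟩ := orFun_props hg0 hg1 hgm hh0 hh1 hhm
  have one0 : ∀ x : Pt d, (0 : ℝ) ≤ (1 : Pt d → ℝ) x := fun _ => zero_le_one
  have h2 : 0 ≤ N3 b (f * (g + h - g * h)) 1 1 - N3 b f (g + h - g * h) 1 := harris3_nonneg b hf0 hfm o0 om one0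
  rw [show f * (g + h - g * h) = f * g + f * h - f * g * h by ring, N3_sub_left, N3_add_left, N3_sub_mid, N3_add_mid] at h2
  linarith

/-- Bonferroni `N(f(1−g)(1−h);1;1) ≥ 0` in coordinates. [this work] -/
theorem bonf_one (hf0 : ∀ x, 0 ≤ f x) (hg1 : ∀ x, g x ≤ 1) (hh1 : ∀ x, h x ≤ 1) :
    0 ≤ N3 b f 1 1 - N3 b (f * g) 1 1 - N3 b (f * h) 1 1 + N3 b (f * g * h) 1 1 := by
  have one0 : ∀ x : Pt d, (0 : ℝ) ≤ (1 : Pt d → ℝ) x := fun _ => zero_le_one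
  have p0 : ∀ x, 0 ≤ (f * (1 - g) * (1 - h)) x := fun x => mul_nonneg (mul_nonneg (hf0 x) (sub_nonneg.2 (hg1 x))) (sub_nonneg.2 (hh1 x))
  have := N3_nonneg b p0 one0 one0
  rw [show f * (1 - g) * (1 - h) = f - f * g - f * h + f * g * h by ring, N3_add_left, N3_sub_left, N3_sub_left] at this; linarith

/-- Bonferroni `N(f(1−g); 1−h; 1) ≥ 0` in coordinates. [this work] -/
theorem bonf_two (hf0 : ∀ x, 0 ≤ f x) (hg1 : ∀ x, g x ≤ 1) (hh1 : ∀ x, h x ≤ 1) :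
    0 ≤ N3 b f 1 1 - N3 b (f * g) 1 1 - N3 b f h 1 + N3 b h (f * g) 1 := by
  have one0 : ∀ x : Pt d, (0 : ℝ) ≤ (1 : Pt d → ℝ) x := fun _ => zero_le_one
  have p0 : ∀ x, 0 ≤ (f * (1 - g)) x := fun x => mul_nonneg (hf0 x) (sub_nonneg.2 (hg1 x))
  have w0 : ∀ x, 0 ≤ (1 - h) x := fun x => sub_nonneg.2 (hh1 x)
  have := N3_nonneg b p0 w0 one0
  rw [show f * (1 - g) = f - f * g by ring, N3_sub_left, N3_sub_mid, N3_sub_mid, N3_comm12 b (f * g) h 1] at this; linarith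

/-- Inclusion–exclusion `N((1−f)(1−g);1;1) ≥ 0` and `N(1−f;1−g;1) ≥ 0` in coordinates. [this work] -/
theorem incl_excl_two (hf1 : ∀ x, f x ≤ 1) (hg1 : ∀ x, g x ≤ 1) :
    0 ≤ N3 b 1 1 1 - N3 b f 1 1 - N3 b g 1 1 + N3 b (f * g) 1 1 ∧ 0 ≤ N3 b 1 1 1 - N3 b f 1 1 - N3 b g 1 1 + N3 b f g 1 := by
  have hp : ∀ x, 0 ≤ (1 - f) x := fun x => sub_nonneg.2 (hf1 x)
  have hq : ∀ x, 0 ≤ (1 - g) x := fun x => sub_nonneg.2 (hg1 x)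
  have one0 : ∀ x : Pt d, (0 : ℝ) ≤ (1 : Pt d → ℝ) x := fun _ => zero_le_one
  have pq0 : ∀ x, 0 ≤ ((1 - f) * (1 - g)) x := fun x => mul_nonneg (hp x) (hq x)
  constructor
  · have := N3_nonneg b pq0 one0 one0
    rw [show (1 - f) * (1 - g) = 1 - f - g + f * g by ring, N3_add_left, N3_sub_left, N3_sub_left] at this; linarith
  · have := N3_nonneg b hp hq one0
    rw [N3_sub_left, N3_sub_mid, N3_sub_mid, N3_comm12 b 1 g 1] at this; linarith

/-- Inclusion–exclusion `N((1−f)(1−g)(1−h)) ≥ 0` in coordinates. [this work] -/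
theorem incl_excl_three (hf1 : ∀ x, f x ≤ 1) (hg1 : ∀ x, g x ≤ 1) (hh1 : ∀ x, h x ≤ 1) :
    0 ≤ N3 b 1 1 1 - N3 b f 1 1 - N3 b g 1 1 - N3 b h 1 1 + N3 b (f * g) 1 1 + N3 b (f * h) 1 1 + N3 b (g * h) 1 1 - N3 b (f * g * h) 1 1 := by
  have one0 : ∀ x : Pt d, (0 : ℝ) ≤ (1 : Pt d → ℝ) x := fun _ => zero_le_one
  have p0 : ∀ x, 0 ≤ ((1 - f) * (1 - g) * (1 - h)) x :=
    fun x => mul_nonneg (mul_nonneg (sub_nonneg.2 (hf1 x)) (sub_nonneg.2 (hg1 x))) (sub_nonneg.2 (hh1 x))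
  have := N3_nonneg b p0 one0 one0
  rw [show (1 - f) * (1 - g) * (1 - h) = 1 - f - g - h + f * g + f * h + g * h - f * g * h by ring] at this
  simp only [N3_add_left, N3_sub_left] at this; linarith

/-- Inclusion–exclusion `N(1−f;1−g;1−h) ≥ 0` in coordinates. [this work] -/
theorem incl_excl_three' (hf1 : ∀ x, f x ≤ 1) (hg1 : ∀ x, g x ≤ 1) (hh1 : ∀ x, h x ≤ 1) :
    0 ≤ N3 b 1 1 1 - N3 b f 1 1 - N3 b g 1 1 - N3 b h 1 1 + N3 b f g 1 + N3 b f h 1 + N3 b g h 1 - N3 b f g h := by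
  have u0 : ∀ x, 0 ≤ (1 - f) x := fun x => sub_nonneg.2 (hf1 x)
  have v0 : ∀ x, 0 ≤ (1 - g) x := fun x => sub_nonneg.2 (hg1 x)
  have w0 : ∀ x, 0 ≤ (1 - h) x := fun x => sub_nonneg.2 (hh1 x)
  have := N3_nonneg b u0 v0 w0
  rw [N3_sub_left, N3_sub_mid, N3_sub_mid, N3_sub_right, N3_sub_right, N3_sub_right, N3_sub_right, N3_comm12 b 1 g 1,
    N3_comm13 b 1 1 h, N3_comm12 b 1 g h, N3_comm23 b g 1 h, N3_comm23 b f 1 h] at this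
  linarith

/-- Inclusion–exclusion `N((1−f)(1−g); 1−h; 1) ≥ 0` in coordinates. [this work] -/
theorem incl_excl_mixed (hf1 : ∀ x, f x ≤ 1) (hg1 : ∀ x, g x ≤ 1) (hh1 : ∀ x, h x ≤ 1) :
    0 ≤ N3 b 1 1 1 - N3 b f 1 1 - N3 b g 1 1 - N3 b h 1 1 + N3 b (f * g) 1 1 + N3 b f h 1 + N3 b g h 1 - N3 b h (f * g) 1 := by
  have one0 : ∀ x : Pt d, (0 : ℝ) ≤ (1 : Pt d → ℝ) x := fun _ => zero_le_one
  have pq0 : ∀ x, 0 ≤ ((1 - f) * (1 - g)) x := fun x => mul_nonneg (sub_nonneg.2 (hf1 x)) (sub_nonneg.2 (hg1 x))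
  have w0 : ∀ x, 0 ≤ (1 - h) x := fun x => sub_nonneg.2 (hh1 x)
  have := N3_nonneg b pq0 w0 one0
  rw [show (1 - f) * (1 - g) = 1 - f - g + f * g by ring, N3_add_left, N3_sub_left, N3_sub_left, N3_sub_mid, N3_sub_mid, N3_sub_mid,
    N3_sub_mid, N3_comm12 b 1 h 1, N3_comm12 b (f * g) h 1] at this
  linarith

/-- Monotonicity in the first copy (second copy nonnegative, third idle). [this work] -/
theorem N3_mono₁ {p q r : Pt d → ℝ} (hpq : ∀ x, p x ≤ q x) (hr : ∀ x, 0 ≤ r x) : N3 b p r 1 ≤ N3 b q r 1 :=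
  N3_mono_left b hpq hr fun _ => zero_le_one

/-- Monotonicity in the second copy. [this work] -/
theorem N3_mono₂ {p q r : Pt d → ℝ} (hpq : ∀ x, p x ≤ q x) (hr : ∀ x, 0 ≤ r x) : N3 b r p 1 ≤ N3 b r q 1 := by
  rw [N3_comm12 b r p 1, N3_comm12 b r q 1]; exact N3_mono₁ b hpq hr

end Facts

/-- Pointwise `pq ≤ q` for `p ∈ [0,1]`, `q ≥ 0`. [this work] -/
theorem mul_le_right' {p q : Pt d → ℝ} (hp1 : ∀ x, p x ≤ 1) (hq : ∀ x, 0 ≤ q x) : ∀ x, (p * q) x ≤ q x :=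
  fun x => by simp only [Pi.mul_apply]; exact mul_le_of_le_one_left (hq x) (hp1 x)

/-- Pointwise `qp ≤ q` for `p ∈ [0,1]`, `q ≥ 0`. [this work] -/
theorem mul_le_left' {p q : Pt d → ℝ} (hp1 : ∀ x, p x ≤ 1) (hq : ∀ x, 0 ≤ q x) : ∀ x, (q * p) x ≤ q x :=
  fun x => by simp only [Pi.mul_apply]; exact mul_le_of_le_one_right (hq x) (hp1 x)

/-- ★ **The fifteen three-copy counts of a monotone `[0,1]`-valued triple satisfy `MixedFacts`.** [this work] -/
theorem mixedFacts_of (b : Fin d → ℕ) {f g h : Pt d → ℝ} (hf0 : ∀ x, 0 ≤ f x) (hf1 : ∀ x, f x ≤ 1) (hfm : Monotone f)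
    (hg0 : ∀ x, 0 ≤ g x) (hg1 : ∀ x, g x ≤ 1) (hgm : Monotone g) (hh0 : ∀ x, 0 ≤ h x) (hh1 : ∀ x, h x ≤ 1) (hhm : Monotone h) :
    MixedFacts (N3 b 1 1 1) (N3 b f 1 1) (N3 b g 1 1) (N3 b h 1 1) (N3 b (f * g) 1 1) (N3 b f g 1) (N3 b (f * h) 1 1) (N3 b f h 1)
      (N3 b (g * h) 1 1) (N3 b g h 1) (N3 b (f * g * h) 1 1) (N3 b f (g * h) 1) (N3 b g (f * h) 1) (N3 b h (f * g) 1) (N3 b f g h) := by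
  have one0 : ∀ x : Pt d, (0 : ℝ) ≤ (1 : Pt d → ℝ) x := fun _ => zero_le_one
  have fg0 : ∀ x, 0 ≤ (f * g) x := fun x => mul_nonneg (hf0 x) (hg0 x)
  have fh0 : ∀ x, 0 ≤ (f * h) x := fun x => mul_nonneg (hf0 x) (hh0 x)
  have gh0 : ∀ x, 0 ≤ (g * h) x := fun x => mul_nonneg (hg0 x) (hh0 x)
  have fgh0 : ∀ x, 0 ≤ (f * g * h) x := fun x => mul_nonneg (fg0 x) (hh0 x)
  have HB : N3 b g (f * h) 1 ≤ N3 b (f * g * h) 1 1 := by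
    have := N3_split_le b hg0 hgm hf0 hfm hh0 hhm; rwa [mul_comm g f] at this
  have HC : N3 b h (f * g) 1 ≤ N3 b (f * g * h) 1 1 := by
    have := N3_split_le b hh0 hhm hf0 hfm hg0 hgm; rwa [mul_comm h f, mul_right_comm f h g] at this
  have H3B : N3 b f g h ≤ N3 b g (f * h) 1 := by
    have := N3_split3_le b hg0 hf0 hfm hh0 hhm; rwa [N3_comm12 b g f h] at this
  have H3C : N3 b f g h ≤ N3 b h (f * g) 1 := by
    have := N3_split3_le b hh0 hf0 hfm hg0 hgm; rwa [N3_comm12 b h f g, N3_comm23 b f h g] at this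
  have SpB : N3 b g (f * h) 1 - N3 b f g h ≤ N3 b (f * h) 1 1 - N3 b f h 1 := by
    have := spec_harris b hf0 hfm hh0 hhm hg1; rwa [N3_comm23 b f h g] at this
  have SpA : N3 b f (g * h) 1 - N3 b f g h ≤ N3 b (g * h) 1 1 - N3 b g h 1 := by
    have := spec_harris b hg0 hgm hh0 hhm hf1; rwa [N3_comm13 b g h f, N3_comm23 b f h g] at this
  have Ug : N3 b (f * g * h) 1 1 - N3 b g (f * h) 1 ≤ (N3 b (f * g) 1 1 - N3 b f g 1) + (N3 b (g * h) 1 1 - N3 b g h 1) := by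
    have := union_harris b hg0 hgm hf0 hf1 hfm hh0 hh1 hhm
    rwa [mul_comm g f, N3_comm12 b g f 1] at this
  have Uh : N3 b (f * g * h) 1 1 - N3 b h (f * g) 1 ≤ (N3 b (f * h) 1 1 - N3 b f h 1) + (N3 b (g * h) 1 1 - N3 b g h 1) := by
    have := union_harris b hh0 hhm hf0 hf1 hfm hg0 hg1 hgm
    rwa [mul_comm h f, mul_right_comm f h g, mul_comm h g, N3_comm12 b h f 1, N3_comm12 b h g 1] at this
  have Bg : 0 ≤ N3 b g 1 1 - N3 b (f * g) 1 1 - N3 b (g * h) 1 1 + N3 b (f * g * h) 1 1 := by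
    have := bonf_one b hg0 hf1 hh1; rwa [mul_comm g f] at this
  have Bh : 0 ≤ N3 b h 1 1 - N3 b (f * h) 1 1 - N3 b (g * h) 1 1 + N3 b (f * g * h) 1 1 := by
    have := bonf_one b hh0 hf1 hg1; rwa [mul_comm h f, mul_comm h g, mul_right_comm f h g] at this
  have Bfh_g : 0 ≤ N3 b f 1 1 - N3 b (f * h) 1 1 - N3 b f g 1 + N3 b g (f * h) 1 := bonf_two b hf0 hh1 hg1
  have Bgf_h : 0 ≤ N3 b g 1 1 - N3 b (f * g) 1 1 - N3 b g h 1 + N3 b h (f * g) 1 := by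
    have := bonf_two b hg0 hf1 hh1; rwa [mul_comm g f] at this
  have Bgh_f : 0 ≤ N3 b g 1 1 - N3 b (g * h) 1 1 - N3 b f g 1 + N3 b f (g * h) 1 := by
    have := bonf_two b hg0 hh1 hf1; rwa [N3_comm12 b g f 1] at this
  have Bhf_g : 0 ≤ N3 b h 1 1 - N3 b (f * h) 1 1 - N3 b g h 1 + N3 b g (f * h) 1 := by
    have := bonf_two b hh0 hf1 hg1; rwa [mul_comm h f, N3_comm12 b h g 1] at this
  have Bhg_f : 0 ≤ N3 b h 1 1 - N3 b (g * h) 1 1 - N3 b f h 1 + N3 b f (g * h) 1 := by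
    have := bonf_two b hh0 hg1 hf1; rwa [mul_comm h g, N3_comm12 b h f 1] at this
  obtain ⟨I2fg, I2fg'⟩ := incl_excl_two b hf1 hg1
  obtain ⟨I2fh, I2fh'⟩ := incl_excl_two b hf1 hh1
  obtain ⟨I2gh, I2gh'⟩ := incl_excl_two b hg1 hh1
  have I3g : 0 ≤ N3 b 1 1 1 - N3 b f 1 1 - N3 b g 1 1 - N3 b h 1 1 + N3 b (f * h) 1 1 + N3 b f g 1 + N3 b g h 1 - N3 b g (f * h) 1 := by
    have := incl_excl_mixed b hf1 hh1 hg1; rw [N3_comm12 b h g 1] at this; linarith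
  have I3f : 0 ≤ N3 b 1 1 1 - N3 b f 1 1 - N3 b g 1 1 - N3 b h 1 1 + N3 b (g * h) 1 1 + N3 b f g 1 + N3 b f h 1 - N3 b f (g * h) 1 := by
    have := incl_excl_mixed b hg1 hh1 hf1; rw [N3_comm12 b g f 1, N3_comm12 b h f 1] at this; linarith
  exact {
    z0 := N3_nonneg b one0 one0 one0, nf0 := N3_nonneg b hf0 one0 one0, ng0 := N3_nonneg b hg0 one0 one0, nh0 := N3_nonneg b hh0 one0 one0,
    hfg0 := N3_nonneg b fg0 one0 one0, sfg0 := N3_nonneg b hf0 hg0 one0, hfh0 := N3_nonneg b fh0 one0 one0, sfh0 := N3_nonneg b hf0 hh0 one0,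
    hgh0 := N3_nonneg b gh0 one0 one0, sgh0 := N3_nonneg b hg0 hh0 one0, n00 := N3_nonneg b fgh0 one0 one0,
    nA0 := N3_nonneg b hf0 gh0 one0, nB0 := N3_nonneg b hg0 fh0 one0, nC0 := N3_nonneg b hh0 fg0 one0, n30 := N3_nonneg b hf0 hg0 hh0,
    fZ := N3_mono₁ b hf1 one0, gZ := N3_mono₁ b hg1 one0, hZ := N3_mono₁ b hh1 one0,
    fg_f := N3_mono₁ b (mul_le_left' hg1 hf0) one0, fg_g := N3_mono₁ b (mul_le_right' hf1 hg0) one0,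
    fh_f := N3_mono₁ b (mul_le_left' hh1 hf0) one0, fh_h := N3_mono₁ b (mul_le_right' hf1 hh0) one0,
    gh_g := N3_mono₁ b (mul_le_left' hh1 hg0) one0, gh_h := N3_mono₁ b (mul_le_right' hg1 hh0) one0,
    sfg_f := N3_mono₂ b hg1 hf0, sfg_g := by rw [N3_comm12 b f g 1]; exact N3_mono₂ b hf1 hg0,
    sfh_f := N3_mono₂ b hh1 hf0, sfh_h := by rw [N3_comm12 b f h 1]; exact N3_mono₂ b hf1 hh0,
    sgh_g := N3_mono₂ b hh1 hg0, sgh_h := by rw [N3_comm12 b g h 1]; exact N3_mono₂ b hg1 hh0,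
    n0_fg := N3_mono₁ b (mul_le_left' hh1 fg0) one0,
    n0_fh := N3_mono₁ b (p := f * g * h) (q := f * h) (fun x => by
      simp only [Pi.mul_apply]; rw [mul_right_comm]; exact mul_le_of_le_one_right (mul_nonneg (hf0 x) (hh0 x)) (hg1 x)) one0,
    n0_gh := N3_mono₁ b (p := f * g * h) (q := g * h) (fun x => by
      simp only [Pi.mul_apply]; rw [mul_assoc]; exact mul_le_of_le_one_left (mul_nonneg (hg0 x) (hh0 x)) (hf1 x)) one0,
    nA_sfg := N3_mono₂ b (mul_le_left' hh1 hg0) hf0, nA_sfh := N3_mono₂ b (mul_le_right' hg1 hh0) hf0,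
    nB_sfg := by rw [N3_comm12 b f g 1]; exact N3_mono₂ b (mul_le_left' hh1 hf0) hg0,
    nB_sgh := N3_mono₂ b (mul_le_right' hf1 hh0) hg0,
    nC_sfh := by rw [N3_comm12 b f h 1]; exact N3_mono₂ b (mul_le_left' hg1 hf0) hh0,
    nC_sgh := by rw [N3_comm12 b g h 1]; exact N3_mono₂ b (mul_le_right' hf1 hg0) hh0,
    Hfg := N3_le_N3_mul d b f g 1 hf0 hfm hg0 hgm one0, Hfh := N3_le_N3_mul d b f h 1 hf0 hfm hh0 hhm one0,
    Hgh := N3_le_N3_mul d b g h 1 hg0 hgm hh0 hhm one0,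
    HA := N3_split_le b hf0 hfm hg0 hgm hh0 hhm, HB := HB, HC := HC,
    H3A := N3_split3_le b hf0 hg0 hgm hh0 hhm, H3B := H3B, H3C := H3C,
    SpC := spec_harris b hf0 hfm hg0 hgm hh1, SpB := SpB, SpA := SpA,
    Uf := union_harris b hf0 hfm hg0 hg1 hgm hh0 hh1 hhm, Ug := Ug, Uh := Uh,
    Bf := bonf_one b hf0 hg1 hh1, Bg := Bg, Bh := Bh,
    Bfg_h := bonf_two b hf0 hg1 hh1, Bfh_g := Bfh_g, Bgf_h := Bgf_h, Bgh_f := Bgh_f, Bhf_g := Bhf_g, Bhg_f := Bhg_f,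
    I2fg := I2fg, I2fh := I2fh, I2gh := I2gh, I2fg' := I2fg', I2fh' := I2fh', I2gh' := I2gh',
    I3 := incl_excl_three b hf1 hg1 hh1, I3' := incl_excl_three' b hf1 hg1 hh1,
    I3f := I3f, I3g := I3g, I3h := incl_excl_mixed b hf1 hg1 hh1 }

end

end Summit.CriticalPhenomena.PercolationContinuityZ3.Theorems.SahiThreeCopy
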